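import Literature.Probability.RandomPlanarGeometry.PlaneNonIntersectionSqrtBound
import HarnessLib

/-!
# Neighbouring starts versus a common start: `f(k+1) ≤ N(k)/16^k ≤ f(k)`

Tenth proof file of the `PlaneNonIntersection` story (named fact
`LSW2001_srw_nonIntersection_five_eighths`, `PlaneNonIntersection.lean`). The fact counts pairs of
`k`-step walks from the NEIGHBOURS `0` and `e₁` with disjoint closed ranges
(`nonIntersectingPairs k = 16^k · P_k`), whereas Lawler's books and the random-walk comparison
theorems (Lawler 1991 Thm. 3.5.1; Lawler 1996; Lawler–Puckette 2000) use two walks from the SAME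
point with the time-`0` point of the first walk removed:
`f(n) = P{S¹(0,n] ∩ S²[0,n] = ∅} = lawlerPairs n / 16^n`. One first-step decomposition and the
lattice symmetries give the exact sandwich

  `lawlerPairs (k+1) ≤ 16 · nonIntersectingPairs k`   and   `nonIntersectingPairs k ≤ lawlerPairs k`  (`k ≥ 1`),

i.e. `f(k+1) ≤ P_k ≤ f(k)` (`lawlerPairs_succ_le`, `nonIntersectingPairs_le_lawlerPairs`,
`lawler_f_succ_le`, `nonIntersectingPairs_div_le_lawler_f`), so every polynomial estimate transfers
between the two normalisations; in particular Lawler's Theorem 3.5.1 (`d = 2`) holds verbatim for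
`f`: `c/k ≤ f(k) ≤ C k^{-1/2}` (`lawler_f_ge`, `lawler_f_le_rpow`).

The last section records the consequences used downstream: `P_{k+1} ≤ P_k`
(`nonIntersectingPairs_div_antitone`), `f(k+1) ≤ f(k)`, `0 < f(k) ≤ 1`, the transfer of a
two-sided power law `≍ k^{-α}` (`α ≥ 0`) in either direction with constants multiplied by `2^α`
(`nonIntersectingPairs_bounds_iff_lawler_f_bounds`), and hence the EQUIVALENCE of the named fact
`LSW2001_srw_nonIntersection_five_eighths` with the same display for Lawler's `f`
(`LSW2001_srw_nonIntersection_five_eighths_iff_lawler_f`) — the common-start normalisation in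
which the random-walk estimates it rests on are printed (Lawler 1996, EJP 1:13, (3) and Thm. 1.3;
Lawler–Puckette 2000). The equivalence proves neither side.

## References

* G. F. Lawler, *Intersections of Random Walks*, Birkhäuser 1991, §3.5, Thm. 3.5.1 [Lawler1991].
* G. F. Lawler, O. Schramm, W. Werner, Acta Math. **187** (2001), §1
  [LawlerSchrammWerner2001PlaneExponents].
-/

noncomputable section

open Finset Real Literature.Probability.LatticeModels Literature.Probability.LatticeModels.SRW
open scoped BigOperators

namespace Literature.Probability.RandomPlanarGeometry

namespace PlaneNonIntersection

/-! ### The two counts -/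

/-- Lawler's count: pairs of `n`-step walks from the origin with `S¹(0,n] ∩ S²[0,n] = ∅`
(`16^n f(n)` in the notation of Lawler 1991, §3.5). [cite: Lawler1991, §3.5] -/
def lawlerPairs (n : ℕ) : ℕ :=
  #{x : StepSeq 2 n × StepSeq 2 n | ∀ i ≤ n, 1 ≤ i → ∀ j ≤ n, pos x.1 i ≠ pos x.2 j}

/-- Pairs of walks of lengths `k` and `t`, the second started at the offset `u`, with disjoint
closed ranges. [folklore] -/
def offsetPairs (k t : ℕ) (u : Site 2) : ℕ :=
  #{x : StepSeq 2 k × StepSeq 2 t | ∀ j ≤ k, ∀ i ≤ t, pos x.1 j ≠ u + pos x.2 i}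

/-- `nonIntersectingPairs k = offsetPairs k k e₁`. [folklore] -/
theorem nonIntersectingPairs_eq_offsetPairs (k : ℕ) : nonIntersectingPairs k = offsetPairs k k e₁ :=
  nonIntersectingPairs_eq_card_filter_stepSeq k

/-- `lawlerPairs` as a double sum of indicators. [folklore] -/
theorem lawlerPairs_eq_sum (n : ℕ) : (lawlerPairs n : ℝ) =
    ∑ ω₁ : StepSeq 2 n, ∑ ω₂ : StepSeq 2 n,
      if ∀ i ≤ n, 1 ≤ i → ∀ j ≤ n, pos ω₁ i ≠ pos ω₂ j then (1 : ℝ) else 0 := by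
  rw [lawlerPairs, Finset.card_filter, Nat.cast_sum, Fintype.sum_prod_type]
  refine Finset.sum_congr rfl fun ω₁ _ => Finset.sum_congr rfl fun ω₂ _ => ?_
  dsimp only
  split_ifs <;> simp

/-- `offsetPairs` as a double sum of indicators. [folklore] -/
theorem offsetPairs_eq_sum (k t : ℕ) (u : Site 2) : (offsetPairs k t u : ℝ) =
    ∑ α : StepSeq 2 k, ∑ β : StepSeq 2 t,
      if ∀ j ≤ k, ∀ i ≤ t, pos α j ≠ u + pos β i then (1 : ℝ) else 0 := by
  rw [offsetPairs, Finset.card_filter, Nat.cast_sum, Fintype.sum_prod_type]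
  refine Finset.sum_congr rfl fun α _ => Finset.sum_congr rfl fun β _ => ?_
  dsimp only
  split_ifs <;> simp

/-! ### Lattice symmetry of the offset count -/

/-- A lattice symmetry transports the offset: for an involutive step map `g` compatible with an
additive map `L` of the lattice with trivial kernel, `offsetPairs k t e_v = offsetPairs k t e_{g v}`.
[folklore] -/
theorem offsetPairs_eq_of_symm (k t : ℕ) (g : Dir 2 → Dir 2) (hg2 : ∀ v, g (g v) = v)
    (L : Site 2 → Site 2) (hL : ∀ x y, L (x + y) = L x + L y) (hL0 : ∀ x, L x = 0 ↔ x = 0)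
    (hg : ∀ v, stepVec (g v) = L (stepVec v)) (v : Dir 2) :
    offsetPairs k t (stepVec v) = offsetPairs k t (stepVec (g v)) := by
  have hL00 : L 0 = 0 := (hL0 0).2 rfl
  have hLinj : ∀ x y, L x = L y ↔ x = y := by
    intro x y
    constructor
    · intro h
      have h2 : L (x - y) + L y = L x := by rw [← hL, sub_add_cancel]
      have h1 : L (x - y) = 0 := by
        have h3 : L (x - y) + L y = 0 + L y := by rw [h2, h, zero_add]
        exact add_right_cancel h3
      exact sub_eq_zero.1 ((hL0 _).1 h1)
    · rintro rfl
      rfl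
  have hGinv : Function.Involutive fun x : StepSeq 2 k × StepSeq 2 t =>
      ((fun i => g (x.1 i) : StepSeq 2 k), (fun i => g (x.2 i) : StepSeq 2 t)) := by
    rintro ⟨α, β⟩
    simp only [Prod.mk.injEq]
    exact ⟨funext fun i => hg2 (α i), funext fun i => hg2 (β i)⟩
  refine Finset.card_bijective _ hGinv.bijective fun x => ?_
  obtain ⟨α, β⟩ := x
  simp only [Finset.mem_filter, Finset.mem_univ, true_and]
  have hα : ∀ j ≤ k, pos (fun i => g (α i)) j = L (pos α j) :=
    fun j hj => pos_comp_eq g L hL hL00 hg α j hj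
  have hβ : ∀ i ≤ t, pos (fun i => g (β i)) i = L (pos β i) :=
    fun i hi => pos_comp_eq g L hL hL00 hg β i hi
  constructor
  · intro h j hj i hi heq
    rw [hα j hj, hβ i hi, hg, ← hL, hLinj] at heq
    exact h j hj i hi heq
  · intro h j hj i hi heq
    refine h j hj i hi ?_
    rw [hα j hj, hβ i hi, hg, ← hL, hLinj]
    exact heq

/-- **The offset count does not depend on the direction of the offset.** [folklore] -/
theorem offsetPairs_stepVec_eq (k t : ℕ) (u v : Dir 2) :
    offsetPairs k t (stepVec u) = offsetPairs k t (stepVec v) := by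
  have hflip : ∀ (a : Fin 2) (w : Dir 2),
      offsetPairs k t (stepVec w) = offsetPairs k t (stepVec (flipDir a w)) :=
    fun a w => offsetPairs_eq_of_symm k t (flipDir a) (flipDir_flipDir a) (flipSite a) (flipSite_add a)
      (flipSite_eq_zero_iff a) (stepVec_flipDir a) w
  have hswap : ∀ w : Dir 2, offsetPairs k t (stepVec w) = offsetPairs k t (stepVec (swapDir w)) :=
    fun w => offsetPairs_eq_of_symm k t swapDir swapDir_swapDir swapSite swapSite_add
      swapSite_eq_zero_iff stepVec_swapDir w
  have key : ∀ w : Dir 2,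
      offsetPairs k t (stepVec w) = offsetPairs k t (stepVec (((0 : Fin 2), true) : Dir 2)) := by
    rintro ⟨b, s⟩
    fin_cases b <;> cases s
    · rw [hflip 0 ((0 : Fin 2), true)]; rfl
    · rfl
    · rw [hswap ((0 : Fin 2), true), hflip 1 (swapDir ((0 : Fin 2), true))]; rfl
    · rw [hswap ((0 : Fin 2), true)]; rfl
  rw [key u, key v]

/-- `offsetPairs k t e_u = offsetPairs k t e₁`. [folklore] -/
theorem offsetPairs_stepVec_eq_e₁ (k t : ℕ) (u : Dir 2) :
    offsetPairs k t (stepVec u) = offsetPairs k t e₁ := by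
  rw [← stepVec_zero_true]
  exact offsetPairs_stepVec_eq k t u _

/-- `Σ_v offsetPairs k t e_v = 4 · offsetPairs k t e₁`. [folklore] -/
theorem sum_offsetPairs_stepVec (k t : ℕ) :
    ∑ v : Dir 2, (offsetPairs k t (stepVec v) : ℝ) = 4 * offsetPairs k t e₁ := by
  rw [Finset.sum_congr rfl fun v _ => by rw [offsetPairs_stepVec_eq_e₁ k t v], Finset.sum_const,
    Finset.card_univ, nsmul_eq_mul]
  norm_num [Fintype.card_prod, Fintype.card_bool, Fintype.card_fin]

/-! ### Splitting off the first step -/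

/-- Splitting off the first step: `Dir 2 × StepSeq 2 k ≃ StepSeq 2 (k+1)`. [folklore] -/
def consEquivS (k : ℕ) : Dir 2 × StepSeq 2 k ≃ StepSeq 2 (k + 1) where
  toFun p := Fin.cons p.1 p.2
  invFun ω := (ω 0, Fin.tail ω)
  left_inv p := by
    obtain ⟨v, β⟩ := p
    simp only [Fin.cons_zero, Fin.tail_cons]
  right_inv ω := Fin.cons_self_tail ω

/-- Summing over `StepSeq 2 (k+1)` = summing over the first step and the rest. [folklore] -/
theorem sum_eq_sum_cons {k : ℕ} (G : StepSeq 2 (k + 1) → ℝ) :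
    ∑ ω : StepSeq 2 (k + 1), G ω = ∑ v : Dir 2, ∑ τ : StepSeq 2 k, G (Fin.cons v τ) := by
  rw [← Fintype.sum_prod_type']
  exact (Fintype.sum_equiv (consEquivS k) (fun p => G (Fin.cons p.1 p.2)) G fun p => rfl).symm

/-- The Lawler condition for a walk with first step `v` and remaining steps `τ` against `ρ` is the
offset condition for `(ρ, τ)` at the offset `e_v`. [folklore] -/
theorem lawlerCond_cons_iff {k t : ℕ} (v : Dir 2) (τ : StepSeq 2 k) (ρ : StepSeq 2 t) :
    (∀ i ≤ k + 1, 1 ≤ i → ∀ j ≤ t, pos (Fin.cons v τ : StepSeq 2 (k + 1)) i ≠ pos ρ j) ↔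
      ∀ j ≤ t, ∀ i ≤ k, pos ρ j ≠ stepVec v + pos τ i := by
  constructor
  · intro h j hj i hi heq
    exact h (i + 1) (by omega) (by omega) j hj (by rw [pos_cons_succ v τ i hi, heq])
  · intro h i hik hi1 j hj heq
    obtain ⟨i', rfl⟩ : ∃ i', i = i' + 1 := ⟨i - 1, by omega⟩
    rw [pos_cons_succ v τ i' (by omega)] at heq
    exact h j hj i' (by omega) heq.symm

/-- After splitting off the first step of `S¹`, Lawler's indicator sum is a sum of offset counts.
[folklore] -/
theorem sum_sum_lawlerCond_eq (k t : ℕ) :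
    ∑ ω₁ : StepSeq 2 (k + 1), ∑ ρ : StepSeq 2 t,
        (if ∀ i ≤ k + 1, 1 ≤ i → ∀ j ≤ t, pos ω₁ i ≠ pos ρ j then (1 : ℝ) else 0) =
      ∑ v : Dir 2, (offsetPairs t k (stepVec v) : ℝ) := by
  rw [sum_eq_sum_cons]
  refine Finset.sum_congr rfl fun v _ => ?_
  rw [offsetPairs_eq_sum, Finset.sum_comm]
  refine Finset.sum_congr rfl fun ρ _ => Finset.sum_congr rfl fun τ _ => ?_
  by_cases h : ∀ j ≤ t, ∀ i ≤ k, pos ρ j ≠ stepVec v + pos τ i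
  · rw [if_pos h, if_pos ((lawlerCond_cons_iff v τ ρ).2 h)]
  · rw [if_neg h, if_neg (mt (lawlerCond_cons_iff v τ ρ).1 h)]

/-! ### `lawlerPairs (k+1) ≤ 16 · nonIntersectingPairs k` -/

/-- **`16^{k+1} f(k+1) ≤ 16 · 16^k P_k`**: drop the last step of the second walk, split off the first
step of the first walk, and use the symmetry of the offset count. [folklore] -/
theorem lawlerPairs_succ_le (k : ℕ) : (lawlerPairs (k + 1) : ℝ) ≤ 16 * nonIntersectingPairs k := by
  have hk : k ≤ k + 1 := Nat.le_succ k
  -- drop the last step of `ω₂`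
  have h2 : ∀ ω₁ ω₂ : StepSeq 2 (k + 1),
      (if ∀ i ≤ k + 1, 1 ≤ i → ∀ j ≤ k + 1, pos ω₁ i ≠ pos ω₂ j then (1 : ℝ) else 0) ≤
        if ∀ i ≤ k + 1, 1 ≤ i → ∀ j ≤ k, pos ω₁ i ≠ pos (pfxS ω₂ k hk) j then (1 : ℝ) else 0 := by
    intro ω₁ ω₂
    split_ifs with ha hb
    · exact le_rfl
    · exact absurd (fun i hik hi1 j hj => by
        rw [pos_pfxS ω₂ hk hj]; exact ha i hik hi1 j (hj.trans hk)) hb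
    · exact zero_le_one
    · exact le_rfl
  have h3 : ∀ ω₁ : StepSeq 2 (k + 1), ∑ ω₂ : StepSeq 2 (k + 1),
      (if ∀ i ≤ k + 1, 1 ≤ i → ∀ j ≤ k, pos ω₁ i ≠ pos (pfxS ω₂ k hk) j then (1 : ℝ) else 0) =
        4 * ∑ ρ : StepSeq 2 k,
          (if ∀ i ≤ k + 1, 1 ≤ i → ∀ j ≤ k, pos ω₁ i ≠ pos ρ j then (1 : ℝ) else 0) := by
    intro ω₁
    rw [sum_comp_pfxS hk (fun ρ => if ∀ i ≤ k + 1, 1 ≤ i → ∀ j ≤ k, pos ω₁ i ≠ pos ρ j then (1 : ℝ) else 0)]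
    norm_num
  calc (lawlerPairs (k + 1) : ℝ)
      = ∑ ω₁ : StepSeq 2 (k + 1), ∑ ω₂ : StepSeq 2 (k + 1),
          (if ∀ i ≤ k + 1, 1 ≤ i → ∀ j ≤ k + 1, pos ω₁ i ≠ pos ω₂ j then (1 : ℝ) else 0) :=
        lawlerPairs_eq_sum (k + 1)
    _ ≤ ∑ ω₁ : StepSeq 2 (k + 1), ∑ ω₂ : StepSeq 2 (k + 1),
          (if ∀ i ≤ k + 1, 1 ≤ i → ∀ j ≤ k, pos ω₁ i ≠ pos (pfxS ω₂ k hk) j then (1 : ℝ) else 0) :=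
        Finset.sum_le_sum fun ω₁ _ => Finset.sum_le_sum fun ω₂ _ => h2 ω₁ ω₂
    _ = 4 * ∑ ω₁ : StepSeq 2 (k + 1), ∑ ρ : StepSeq 2 k,
          (if ∀ i ≤ k + 1, 1 ≤ i → ∀ j ≤ k, pos ω₁ i ≠ pos ρ j then (1 : ℝ) else 0) := by
        rw [Finset.mul_sum]
        exact Finset.sum_congr rfl fun ω₁ _ => h3 ω₁
    _ = 4 * (4 * nonIntersectingPairs k) := by
        rw [sum_sum_lawlerCond_eq, sum_offsetPairs_stepVec, nonIntersectingPairs_eq_offsetPairs]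
    _ = 16 * nonIntersectingPairs k := by ring

/-! ### `nonIntersectingPairs k ≤ lawlerPairs k` -/

/-- **`16^k P_k ≤ 16^k f(k)`** (`k ≥ 1`): constrain only the first `k - 1` steps of the walk from
`e₁`, and recognise Lawler's count after splitting off the first step of `S¹`. [folklore] -/
theorem nonIntersectingPairs_le_lawlerPairs {k : ℕ} (hk : 1 ≤ k) :
    (nonIntersectingPairs k : ℝ) ≤ lawlerPairs k := by
  obtain ⟨k', rfl⟩ : ∃ k', k = k' + 1 := ⟨k - 1, by omega⟩
  have hk' : k' ≤ k' + 1 := Nat.le_succ k'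
  -- `N ≤ 4 · offsetPairs (k'+1) k' e₁`
  have hle : ∀ α β : StepSeq 2 (k' + 1),
      (if ∀ j ≤ k' + 1, ∀ i ≤ k' + 1, pos α j ≠ e₁ + pos β i then (1 : ℝ) else 0) ≤
        if ∀ j ≤ k' + 1, ∀ i ≤ k', pos α j ≠ e₁ + pos (pfxS β k' hk') i then (1 : ℝ) else 0 := by
    intro α β
    split_ifs with ha hb
    · exact le_rfl
    · exact absurd (fun j hj i hi => by rw [pos_pfxS β hk' hi]; exact ha j hj i (hi.trans hk')) hb
    · exact zero_le_one
    · exact le_rfl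
  have h1 : (nonIntersectingPairs (k' + 1) : ℝ) ≤ 4 * offsetPairs (k' + 1) k' e₁ := by
    rw [nonIntersectingPairs_eq_offsetPairs, offsetPairs_eq_sum, offsetPairs_eq_sum, Finset.mul_sum]
    refine Finset.sum_le_sum fun α _ => ?_
    calc ∑ β : StepSeq 2 (k' + 1),
          (if ∀ j ≤ k' + 1, ∀ i ≤ k' + 1, pos α j ≠ e₁ + pos β i then (1 : ℝ) else 0)
        ≤ ∑ β : StepSeq 2 (k' + 1),
          (if ∀ j ≤ k' + 1, ∀ i ≤ k', pos α j ≠ e₁ + pos (pfxS β k' hk') i then (1 : ℝ) else 0) :=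
          Finset.sum_le_sum fun β _ => hle α β
      _ = 4 ^ (k' + 1 - k') * ∑ β' : StepSeq 2 k',
          (if ∀ j ≤ k' + 1, ∀ i ≤ k', pos α j ≠ e₁ + pos β' i then (1 : ℝ) else 0) :=
          sum_comp_pfxS hk' (fun β' => if ∀ j ≤ k' + 1, ∀ i ≤ k', pos α j ≠ e₁ + pos β' i then (1 : ℝ) else 0)
      _ = 4 * ∑ β' : StepSeq 2 k',
          (if ∀ j ≤ k' + 1, ∀ i ≤ k', pos α j ≠ e₁ + pos β' i then (1 : ℝ) else 0) := by
          norm_num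
  -- `lawlerPairs (k'+1) = Σ_v offsetPairs (k'+1) k' e_v = 4 · offsetPairs (k'+1) k' e₁`
  have h2 : (lawlerPairs (k' + 1) : ℝ) = 4 * offsetPairs (k' + 1) k' e₁ := by
    rw [lawlerPairs_eq_sum, sum_sum_lawlerCond_eq, sum_offsetPairs_stepVec]
  rw [h2]
  exact h1

/-! ### The sandwich in probability form and Lawler's Theorem 3.5.1 for `f` -/

/-- **`f(k+1) ≤ P_k`**: `lawlerPairs (k+1)/16^{k+1} ≤ nonIntersectingPairs k/16^k`. [folklore] -/
theorem lawler_f_succ_le (k : ℕ) :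
    (lawlerPairs (k + 1) : ℝ) / 16 ^ (k + 1) ≤ (nonIntersectingPairs k : ℝ) / 16 ^ k := by
  rw [div_le_div_iff₀ (by positivity) (by positivity), pow_succ]
  have := lawlerPairs_succ_le k
  have h16 : (0 : ℝ) ≤ 16 ^ k := by positivity
  nlinarith

/-- **`P_k ≤ f(k)`** (`k ≥ 1`): `nonIntersectingPairs k/16^k ≤ lawlerPairs k/16^k`. [folklore] -/
theorem nonIntersectingPairs_div_le_lawler_f {k : ℕ} (hk : 1 ≤ k) :
    (nonIntersectingPairs k : ℝ) / 16 ^ k ≤ (lawlerPairs k : ℝ) / 16 ^ k :=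
  div_le_div_of_nonneg_right (nonIntersectingPairs_le_lawlerPairs hk) (by positivity)

/-- **Lawler's Theorem 3.5.1, `d = 2`, upper half, for `f`**: `f(k) ≤ C k^{-1/2}` (from
`f(k) ≤ P_{k-1} ≤ C (k-1)^{-1/2} ≤ 2C · k^{-1/2}` for `k ≥ 2`). [cite: Lawler1991, Thm. 3.5.1 / (3.29)] -/
theorem lawler_f_le_rpow :
    ∃ C : ℝ, 0 < C ∧ ∀ k : ℕ, 1 ≤ k → (lawlerPairs k : ℝ) / 16 ^ k ≤ C * (k : ℝ) ^ (-(1 / 2 : ℝ)) := by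
  obtain ⟨C, hC, hb⟩ := nonIntersectingPairs_div_le_rpow
  refine ⟨2 * C + 1, by positivity, fun k hk => ?_⟩
  have hk0 : (0 : ℝ) < k := by exact_mod_cast hk
  have hrk : 0 < (k : ℝ) ^ (-(1 / 2 : ℝ)) := Real.rpow_pos_of_pos hk0 _
  rcases Nat.lt_or_ge k 2 with hk1 | hk2
  · -- `k = 1`: `f(1) ≤ 1`
    have hk1' : k = 1 := by omega
    subst hk1'
    have hle : (lawlerPairs 1 : ℝ) / 16 ^ 1 ≤ 1 := by
      rw [div_le_one (by positivity)]
      have : lawlerPairs 1 ≤ Fintype.card (StepSeq 2 1 × StepSeq 2 1) := Finset.card_le_univ _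
      rw [Fintype.card_prod, card_stepSeq] at this
      exact_mod_cast this
    rw [Nat.cast_one, Real.one_rpow, mul_one]
    linarith
  · obtain ⟨k', rfl⟩ : ∃ k', k = k' + 1 := ⟨k - 1, by omega⟩
    have hk'1 : 1 ≤ k' := by omega
    have h1 := lawler_f_succ_le k'
    have h2 := hb k' hk'1
    have hk'0 : (0 : ℝ) < k' := by exact_mod_cast hk'1
    -- `(k')^{-1/2} ≤ 2 (k'+1)^{-1/2}` since `k' + 1 ≤ 4 k'`
    have h3 : (k' : ℝ) ^ (-(1 / 2 : ℝ)) ≤ 2 * ((k' + 1 : ℕ) : ℝ) ^ (-(1 / 2 : ℝ)) := by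
      have e1 : (k' : ℝ) ^ (-(1 / 2 : ℝ)) = 1 / Real.sqrt k' := by
        rw [Real.rpow_neg hk'0.le, Real.sqrt_eq_rpow, inv_eq_one_div]
      have e2 : ((k' + 1 : ℕ) : ℝ) ^ (-(1 / 2 : ℝ)) = 1 / Real.sqrt ((k' + 1 : ℕ) : ℝ) := by
        rw [Real.rpow_neg (by positivity), Real.sqrt_eq_rpow, inv_eq_one_div]
      have hs : Real.sqrt ((k' + 1 : ℕ) : ℝ) ≤ 2 * Real.sqrt k' := by
        have h4 : Real.sqrt 4 = 2 := by
          rw [show (4 : ℝ) = 2 ^ 2 by norm_num, Real.sqrt_sq (by norm_num)]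
        rw [← h4, ← Real.sqrt_mul (by norm_num)]
        refine Real.sqrt_le_sqrt ?_
        have : ((k' + 1 : ℕ) : ℝ) ≤ 4 * k' := by
          have h5 : k' + 1 ≤ 4 * k' := by omega
          exact_mod_cast h5
        exact this
      have hpos1 : 0 < Real.sqrt k' := Real.sqrt_pos.2 hk'0
      have hpos2 : 0 < Real.sqrt ((k' + 1 : ℕ) : ℝ) := Real.sqrt_pos.2 (by positivity)
      rw [e1, e2, mul_one_div, div_le_div_iff₀ hpos1 hpos2, one_mul]
      exact hs
    calc (lawlerPairs (k' + 1) : ℝ) / 16 ^ (k' + 1) ≤ (nonIntersectingPairs k' : ℝ) / 16 ^ k' := h1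
      _ ≤ C * (k' : ℝ) ^ (-(1 / 2 : ℝ)) := h2
      _ ≤ C * (2 * ((k' + 1 : ℕ) : ℝ) ^ (-(1 / 2 : ℝ))) := mul_le_mul_of_nonneg_left h3 hC.le
      _ ≤ (2 * C + 1) * ((k' + 1 : ℕ) : ℝ) ^ (-(1 / 2 : ℝ)) := by nlinarith [hrk]

/-- **Lawler's Theorem 3.5.1, `d = 2`, lower half, for `f`**: `f(k) ≥ 1/(2(k+1))` (`k ≥ 1`).
[cite: Lawler1991, Thm. 3.5.1 / (3.29)] -/
theorem lawler_f_ge {k : ℕ} (hk : 1 ≤ k) : (2 * ((k : ℝ) + 1))⁻¹ ≤ (lawlerPairs k : ℝ) / 16 ^ k :=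
  (inv_le_nonIntersectingPairs_div k).trans (nonIntersectingPairs_div_le_lawler_f hk)

/-! ### Monotonicity, and transfer of power laws between the two normalisations -/

/-- **`N(k+1) ≤ 16 · N(k)`**: extending both walks by one step can only destroy disjointness
(through `N(k+1) ≤ 16^{k+1} f(k+1) ≤ 16 N(k)`). [folklore] -/
theorem nonIntersectingPairs_succ_le (k : ℕ) :
    (nonIntersectingPairs (k + 1) : ℝ) ≤ 16 * nonIntersectingPairs k :=
  (nonIntersectingPairs_le_lawlerPairs (k := k + 1) (by omega)).trans (lawlerPairs_succ_le k)

/-- **`P_{k+1} ≤ P_k`.** [folklore] -/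
theorem nonIntersectingPairs_div_succ_le (k : ℕ) :
    (nonIntersectingPairs (k + 1) : ℝ) / 16 ^ (k + 1) ≤ (nonIntersectingPairs k : ℝ) / 16 ^ k := by
  rw [div_le_div_iff₀ (by positivity) (by positivity), pow_succ]
  have := nonIntersectingPairs_succ_le k
  have h16 : (0 : ℝ) ≤ 16 ^ k := by positivity
  nlinarith

/-- **`k ↦ P_k = N(k)/16^k` is non-increasing.** [folklore] -/
theorem nonIntersectingPairs_div_antitone :
    Antitone fun k : ℕ => (nonIntersectingPairs k : ℝ) / 16 ^ k :=
  antitone_nat_of_succ_le nonIntersectingPairs_div_succ_le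

/-- **`f(k+1) ≤ f(k)`** (`k ≥ 1`). [folklore] -/
theorem lawler_f_succ_le_lawler_f {k : ℕ} (hk : 1 ≤ k) :
    (lawlerPairs (k + 1) : ℝ) / 16 ^ (k + 1) ≤ (lawlerPairs k : ℝ) / 16 ^ k :=
  (lawler_f_succ_le k).trans (nonIntersectingPairs_div_le_lawler_f hk)

/-- **`f(k) ≤ 1`.** [folklore] -/
theorem lawler_f_le_one (k : ℕ) : (lawlerPairs k : ℝ) / 16 ^ k ≤ 1 := by
  rw [div_le_one (by positivity)]
  have h : lawlerPairs k ≤ Fintype.card (StepSeq 2 k × StepSeq 2 k) := Finset.card_le_univ _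
  rw [Fintype.card_prod, card_stepSeq, ← mul_pow] at h
  norm_num at h
  exact_mod_cast h

/-- **`0 < f(k)`** (`k ≥ 1`). [folklore] -/
theorem lawler_f_pos {k : ℕ} (hk : 1 ≤ k) : 0 < (lawlerPairs k : ℝ) / 16 ^ k :=
  (nonIntersectingPairs_div_pos k).trans_le (nonIntersectingPairs_div_le_lawler_f hk)

/-- `k^{-α} ≤ 2^α (k+1)^{-α}` for `k ≥ 1` and `α ≥ 0` (from `k + 1 ≤ 2k`). [folklore] -/
theorem rpow_neg_le_two_rpow_mul_succ_rpow_neg {k : ℕ} (hk : 1 ≤ k) {α : ℝ} (hα : 0 ≤ α) :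
    (k : ℝ) ^ (-α) ≤ (2 : ℝ) ^ α * ((k + 1 : ℕ) : ℝ) ^ (-α) := by
  have hk0 : (0 : ℝ) < k := by exact_mod_cast hk
  have hk1 : (0 : ℝ) < ((k + 1 : ℕ) : ℝ) := by positivity
  have h2k : ((k + 1 : ℕ) : ℝ) ≤ 2 * k := by
    have : k + 1 ≤ 2 * k := by omega
    exact_mod_cast this
  have hpow : ((k + 1 : ℕ) : ℝ) ^ α ≤ (2 : ℝ) ^ α * (k : ℝ) ^ α := by
    rw [← Real.mul_rpow (by norm_num) hk0.le]
    exact Real.rpow_le_rpow hk1.le h2k hα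
  have hkα : 0 < (k : ℝ) ^ α := Real.rpow_pos_of_pos hk0 α
  have hk1α : 0 < ((k + 1 : ℕ) : ℝ) ^ α := Real.rpow_pos_of_pos hk1 α
  rw [Real.rpow_neg hk0.le, Real.rpow_neg hk1.le, ← one_div, ← div_eq_mul_inv,
    div_le_div_iff₀ hkα hk1α, one_mul]
  exact hpow

/-- **Transfer `P → f`.** If `c⁻¹ k^{-α} ≤ P_k ≤ c k^{-α}` for all `k ≥ 1` (`α ≥ 0`), then the
same holds for `f` with the constant `2^α c + 1` (lower half through `P_k ≤ f(k)`; upper half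
through `f(k) ≤ P_{k-1}` for `k ≥ 2` and `f(1) ≤ 1`). [folklore] -/
theorem lawler_f_bounds_of_nonIntersectingPairs_bounds {α c : ℝ} (hα : 0 ≤ α) (hc : 0 < c)
    (h : ∀ k : ℕ, 1 ≤ k →
      c⁻¹ * (k : ℝ) ^ (-α) ≤ (nonIntersectingPairs k : ℝ) / 16 ^ k ∧
        (nonIntersectingPairs k : ℝ) / 16 ^ k ≤ c * (k : ℝ) ^ (-α)) :
    ∀ k : ℕ, 1 ≤ k →
      (2 ^ α * c + 1)⁻¹ * (k : ℝ) ^ (-α) ≤ (lawlerPairs k : ℝ) / 16 ^ k ∧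
        (lawlerPairs k : ℝ) / 16 ^ k ≤ (2 ^ α * c + 1) * (k : ℝ) ^ (-α) := by
  intro k hk
  have hk0 : (0 : ℝ) < k := by exact_mod_cast hk
  have hrk : 0 < (k : ℝ) ^ (-α) := Real.rpow_pos_of_pos hk0 _
  have h2α : (1 : ℝ) ≤ 2 ^ α := Real.one_le_rpow (by norm_num) hα
  have hc' : c ≤ 2 ^ α * c + 1 := by nlinarith [mul_nonneg (sub_nonneg.2 h2α) hc.le]
  constructor
  · have h1 := (h k hk).1
    have h2 := nonIntersectingPairs_div_le_lawler_f hk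
    have h3 : (2 ^ α * c + 1)⁻¹ ≤ c⁻¹ := inv_anti₀ hc hc'
    calc (2 ^ α * c + 1)⁻¹ * (k : ℝ) ^ (-α) ≤ c⁻¹ * (k : ℝ) ^ (-α) :=
          mul_le_mul_of_nonneg_right h3 hrk.le
      _ ≤ (lawlerPairs k : ℝ) / 16 ^ k := h1.trans h2
  · rcases Nat.lt_or_ge k 2 with hk1 | hk2
    · have hk1' : k = 1 := by omega
      subst hk1'
      rw [Nat.cast_one, Real.one_rpow, mul_one]
      have h1 := lawler_f_le_one 1
      have hpos : (0 : ℝ) < 2 ^ α * c := by positivity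
      linarith
    · obtain ⟨k', rfl⟩ : ∃ k', k = k' + 1 := ⟨k - 1, by omega⟩
      have hk'1 : 1 ≤ k' := by omega
      have h1 := lawler_f_succ_le k'
      have h2 := (h k' hk'1).2
      have h3 := rpow_neg_le_two_rpow_mul_succ_rpow_neg hk'1 hα
      have hr' : 0 < ((k' + 1 : ℕ) : ℝ) ^ (-α) := Real.rpow_pos_of_pos (by positivity) _
      calc (lawlerPairs (k' + 1) : ℝ) / 16 ^ (k' + 1)
          ≤ (nonIntersectingPairs k' : ℝ) / 16 ^ k' := h1
        _ ≤ c * (k' : ℝ) ^ (-α) := h2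
        _ ≤ c * (2 ^ α * ((k' + 1 : ℕ) : ℝ) ^ (-α)) := mul_le_mul_of_nonneg_left h3 hc.le
        _ ≤ (2 ^ α * c + 1) * ((k' + 1 : ℕ) : ℝ) ^ (-α) := by nlinarith

/-- **Transfer `f → P`.** If `c⁻¹ k^{-α} ≤ f(k) ≤ c k^{-α}` for all `k ≥ 1` (`α ≥ 0`), then the
same holds for `P_k` with the constant `2^α c` (upper half through `P_k ≤ f(k)`; lower half through
`f(k+1) ≤ P_k`). [folklore] -/
theorem nonIntersectingPairs_bounds_of_lawler_f_bounds {α c : ℝ} (hα : 0 ≤ α) (hc : 0 < c)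
    (h : ∀ k : ℕ, 1 ≤ k →
      c⁻¹ * (k : ℝ) ^ (-α) ≤ (lawlerPairs k : ℝ) / 16 ^ k ∧
        (lawlerPairs k : ℝ) / 16 ^ k ≤ c * (k : ℝ) ^ (-α)) :
    ∀ k : ℕ, 1 ≤ k →
      (2 ^ α * c)⁻¹ * (k : ℝ) ^ (-α) ≤ (nonIntersectingPairs k : ℝ) / 16 ^ k ∧
        (nonIntersectingPairs k : ℝ) / 16 ^ k ≤ 2 ^ α * c * (k : ℝ) ^ (-α) := by
  intro k hk
  have hk0 : (0 : ℝ) < k := by exact_mod_cast hk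
  have hrk : 0 < (k : ℝ) ^ (-α) := Real.rpow_pos_of_pos hk0 _
  have h2α : (1 : ℝ) ≤ 2 ^ α := Real.one_le_rpow (by norm_num) hα
  have h2α0 : (0 : ℝ) < 2 ^ α := by positivity
  constructor
  · have h1 := lawler_f_succ_le k
    have h2 := (h (k + 1) (by omega)).1
    have h3 := rpow_neg_le_two_rpow_mul_succ_rpow_neg hk hα
    calc (2 ^ α * c)⁻¹ * (k : ℝ) ^ (-α)
        ≤ (2 ^ α * c)⁻¹ * (2 ^ α * ((k + 1 : ℕ) : ℝ) ^ (-α)) :=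
          mul_le_mul_of_nonneg_left h3 (by positivity)
      _ = c⁻¹ * ((k + 1 : ℕ) : ℝ) ^ (-α) := by
          rw [mul_inv, mul_mul_mul_comm, inv_mul_cancel₀ h2α0.ne', one_mul]
      _ ≤ (nonIntersectingPairs k : ℝ) / 16 ^ k := h2.trans h1
  · have h1 := nonIntersectingPairs_div_le_lawler_f hk
    have h2 := (h k hk).2
    calc (nonIntersectingPairs k : ℝ) / 16 ^ k ≤ (lawlerPairs k : ℝ) / 16 ^ k := h1
      _ ≤ c * (k : ℝ) ^ (-α) := h2
      _ ≤ 2 ^ α * c * (k : ℝ) ^ (-α) := by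
          nlinarith [mul_nonneg (sub_nonneg.2 h2α) (mul_pos hc hrk).le]

/-- **The two normalisations carry the same two-sided power laws**: for `α ≥ 0`,
`P_k ≍ k^{-α}` (all `k ≥ 1`) iff `f(k) ≍ k^{-α}` (all `k ≥ 1`). [folklore] -/
theorem nonIntersectingPairs_bounds_iff_lawler_f_bounds {α : ℝ} (hα : 0 ≤ α) :
    (∃ c : ℝ, 0 < c ∧ ∀ k : ℕ, 1 ≤ k →
        c⁻¹ * (k : ℝ) ^ (-α) ≤ (nonIntersectingPairs k : ℝ) / 16 ^ k ∧
          (nonIntersectingPairs k : ℝ) / 16 ^ k ≤ c * (k : ℝ) ^ (-α)) ↔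
      ∃ c : ℝ, 0 < c ∧ ∀ k : ℕ, 1 ≤ k →
        c⁻¹ * (k : ℝ) ^ (-α) ≤ (lawlerPairs k : ℝ) / 16 ^ k ∧
          (lawlerPairs k : ℝ) / 16 ^ k ≤ c * (k : ℝ) ^ (-α) := by
  constructor
  · rintro ⟨c, hc, h⟩
    exact ⟨2 ^ α * c + 1, by positivity, lawler_f_bounds_of_nonIntersectingPairs_bounds hα hc h⟩
  · rintro ⟨c, hc, h⟩
    exact ⟨2 ^ α * c, by positivity, nonIntersectingPairs_bounds_of_lawler_f_bounds hα hc h⟩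

end PlaneNonIntersection

open PlaneNonIntersection in
/-- **The Lawler–Schramm–Werner display in Lawler's normalisation.** The named fact
`LSW2001_srw_nonIntersection_five_eighths` (walks from the neighbours `0` and `e₁`, closed ranges
disjoint, `c⁻¹ k^{-5/8} ≤ P_k ≤ c k^{-5/8}` for `k ≥ 1`) is EQUIVALENT to the same two-sided
estimate for Lawler's `f(n) = P{S¹(0,n] ∩ S²[0,n] = ∅} = lawlerPairs n / 16^n` (both walks from
the origin) — the normalisation of the random-walk estimates [Lawler 1996, EJP 1:13, (3) and
Thm. 1.3; Lawler–Puckette 2000] which, combined with `ζ₂ = 5/8` [LSW 2001, Thm. 1], the source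
invokes for the display. This is the elementary equivalence only (the sandwich
`f(k+1) ≤ P_k ≤ f(k)`); it proves neither side.
[cite: LawlerSchrammWerner2001PlaneExponents, §1 (display after Thm 1)] -/
theorem LSW2001_srw_nonIntersection_five_eighths_iff_lawler_f :
    LSW2001_srw_nonIntersection_five_eighths ↔
      ∃ c : ℝ, 0 < c ∧ ∀ n : ℕ, 1 ≤ n →
        c⁻¹ * (n : ℝ) ^ (-(5 / 8 : ℝ)) ≤ (lawlerPairs n : ℝ) / 16 ^ n ∧
          (lawlerPairs n : ℝ) / 16 ^ n ≤ c * (n : ℝ) ^ (-(5 / 8 : ℝ)) :=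
  nonIntersectingPairs_bounds_iff_lawler_f_bounds (α := 5 / 8) (by norm_num)

end Literature.Probability.RandomPlanarGeometry

end
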